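import Mathlib
import Summits.Ventures.PercRepro2.HCov
import Summits.Ventures.PercRepro2.RECMReduction
import Summits.Ventures.PercRepro2.GcSkelRules
import Summits.Ventures.PercRepro2.GcSkelReductionI
import Summits.Ventures.PercRepro2.GcSkelSplitG1
import Summits.Ventures.PercRepro2.GcBlock
import Summits.Ventures.PercRepro2.GcSkelReductionT
import Summits.Ventures.PercRepro2.GcSkelReductionTW

/-!
# The crux as (G1) + the cores, on the residual with no collapsible block (blind cell
PercRepro2, typer-1 g54)

`GcSkelSplitG1.lean` (g53) splits the crux along the non-loop degree of `a₃` on `WReducedI`: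
`HCov_all ↔ HCovG1_all ∧ HCovCore_all`. The same split on the sharper residual `WReducedT`
(`GcSkelReductionT.lean`):

* **`HCovG1T_all`** / **`HCovCoreT_all`** — (HCOV) on the `WReducedT` instances with `a₃` a leaf /
  not a leaf; **`HCov_all_iff_G1T_and_CoreT`**;
* the two pieces are implied by g53's (`HCovG1T_all_of_HCovG1_all`, `HCovCoreT_all_of_HCovCore_all`
  — fewer instances), and each is equivalent to its g53 counterpart once the other piece holds
  (`HCovG1_all_of_G1T_and_CoreT`, `HCovCore_all_of_G1T_and_CoreT`): the block collapse can move an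
  instance from one piece to the other, so the equivalence is of the pairs, not piece by piece;
* **`core_marksReach`** — on the cores every unmarked vertex of positive non-loop degree reaches
  a mark past any two vertices (`MarksReach`), on top of g53's two-connectivity.
-/

namespace Summit.Ventures.PercRepro2

open CovForm RECM

namespace WRed

section Closures

variable (R : Type*) [Field R] [LinearOrder R] [IsStrictOrderedRing R]

/-- **(G1) on the residual with no collapsible block**: (HCOV) on the `WReducedT` instances in
which `a₃` is a leaf. -/
def HCovG1T_all : Prop :=
  ∀ (V E : Type) [Fintype V] [DecidableEq V] [Fintype E] [DecidableEq E]
    (ends : E → Sym2 V) (p : E → R), IsProbVec p →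
    ∀ o a₁ a₂ a₃ b : V, a₁ ≠ a₂ → a₁ ≠ a₃ → a₂ ≠ a₃ → o ≠ a₁ → o ≠ a₂ → o ≠ a₃ → o ≠ b →
      b ≠ a₁ → b ≠ a₂ → b ≠ a₃ → WReducedT ends o a₁ a₂ a₃ b → nonLoopDeg ends a₃ = 1 →
      HCov p ends o a₁ a₂ a₃ b

/-- **The cores of the residual with no collapsible block**: (HCOV) on the `WReducedT` instances
in which `a₃` is not a leaf. -/
def HCovCoreT_all : Prop :=
  ∀ (V E : Type) [Fintype V] [DecidableEq V] [Fintype E] [DecidableEq E]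
    (ends : E → Sym2 V) (p : E → R), IsProbVec p →
    ∀ o a₁ a₂ a₃ b : V, a₁ ≠ a₂ → a₁ ≠ a₃ → a₂ ≠ a₃ → o ≠ a₁ → o ≠ a₂ → o ≠ a₃ → o ≠ b →
      b ≠ a₁ → b ≠ a₂ → b ≠ a₃ → WReducedT ends o a₁ a₂ a₃ b → nonLoopDeg ends a₃ ≠ 1 →
      HCov p ends o a₁ a₂ a₃ b

end Closures

section Main

variable {R : Type*} [Field R] [LinearOrder R] [IsStrictOrderedRing R]

omit [IsStrictOrderedRing R] in
/-- The closure of the residual with no collapsible block is (G1) together with the cores. -/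
theorem HCovWRedT_all_iff_G1T_and_CoreT : HCovWRedT_all R ↔ HCovG1T_all R ∧ HCovCoreT_all R := by
  constructor
  · intro h
    exact ⟨fun V E _ _ _ _ ends p hp o a₁ a₂ a₃ b h12 h13 h23 ho1 ho2 ho3 hob hb1 hb2 hb3 hred _ =>
        h V E ends p hp o a₁ a₂ a₃ b h12 h13 h23 ho1 ho2 ho3 hob hb1 hb2 hb3 hred,
      fun V E _ _ _ _ ends p hp o a₁ a₂ a₃ b h12 h13 h23 ho1 ho2 ho3 hob hb1 hb2 hb3 hred _ =>
        h V E ends p hp o a₁ a₂ a₃ b h12 h13 h23 ho1 ho2 ho3 hob hb1 hb2 hb3 hred⟩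
  · rintro ⟨hG, hC⟩ V E _ _ _ _ ends p hp o a₁ a₂ a₃ b h12 h13 h23 ho1 ho2 ho3 hob hb1 hb2 hb3 hred
    by_cases hd : nonLoopDeg ends a₃ = 1
    · exact hG V E ends p hp o a₁ a₂ a₃ b h12 h13 h23 ho1 ho2 ho3 hob hb1 hb2 hb3 hred hd
    · exact hC V E ends p hp o a₁ a₂ a₃ b h12 h13 h23 ho1 ho2 ho3 hob hb1 hb2 hb3 hred hd

/-- **THE CRUX IN TWO NAMED PIECES, on the residual with no collapsible block**: (HCOV) for every
finite weighted graph with five distinct marks is exactly (G1) on `WReducedT` together with (HCOV)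
on its cores. -/
theorem HCov_all_iff_G1T_and_CoreT : HCov_all R ↔ HCovG1T_all R ∧ HCovCoreT_all R :=
  HCov_all_iff_HCovWRedT_all.trans HCovWRedT_all_iff_G1T_and_CoreT

omit [IsStrictOrderedRing R] in
/-- (G1) on `WReducedT` is implied by (G1) on `WReducedI` (fewer instances). -/
theorem HCovG1T_all_of_HCovG1_all (h : HCovG1_all R) : HCovG1T_all R :=
  fun V E _ _ _ _ ends p hp o a₁ a₂ a₃ b h12 h13 h23 ho1 ho2 ho3 hob hb1 hb2 hb3 hred hd =>
    h V E ends p hp o a₁ a₂ a₃ b h12 h13 h23 ho1 ho2 ho3 hob hb1 hb2 hb3 hred.toWReducedI hd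

omit [IsStrictOrderedRing R] in
/-- The cores of `WReducedT` are implied by the cores of `WReducedI` (fewer instances). -/
theorem HCovCoreT_all_of_HCovCore_all (h : HCovCore_all R) : HCovCoreT_all R :=
  fun V E _ _ _ _ ends p hp o a₁ a₂ a₃ b h12 h13 h23 ho1 ho2 ho3 hob hb1 hb2 hb3 hred hd =>
    h V E ends p hp o a₁ a₂ a₃ b h12 h13 h23 ho1 ho2 ho3 hob hb1 hb2 hb3 hred.toWReducedI hd

/-- Both pieces on `WReducedT` give g53's (G1) on `WReducedI` (through the crux itself). -/
theorem HCovG1_all_of_G1T_and_CoreT (hG : HCovG1T_all R) (hC : HCovCoreT_all R) : HCovG1_all R :=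
  fun V E _ _ _ _ ends p hp o a₁ a₂ a₃ b h12 h13 h23 ho1 ho2 ho3 hob hb1 hb2 hb3 _ _ =>
    (HCov_all_iff_G1T_and_CoreT.2 ⟨hG, hC⟩) V E ends p hp o a₁ a₂ a₃ b h12 h13 h23 ho1 ho2 ho3 hob
      hb1 hb2 hb3

/-- Both pieces on `WReducedT` give g53's cores on `WReducedI` (through the crux itself). -/
theorem HCovCore_all_of_G1T_and_CoreT (hG : HCovG1T_all R) (hC : HCovCoreT_all R) :
    HCovCore_all R :=
  fun V E _ _ _ _ ends p hp o a₁ a₂ a₃ b h12 h13 h23 ho1 ho2 ho3 hob hb1 hb2 hb3 _ _ =>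
    (HCov_all_iff_G1T_and_CoreT.2 ⟨hG, hC⟩) V E ends p hp o a₁ a₂ a₃ b h12 h13 h23 ho1 ho2 ho3 hob
      hb1 hb2 hb3

/-- The pairs are equivalent: `(G1, cores)` on `WReducedI` ⟺ `(G1, cores)` on `WReducedT`. -/
theorem G1_and_Core_iff_G1T_and_CoreT :
    (HCovG1_all R ∧ HCovCore_all R) ↔ (HCovG1T_all R ∧ HCovCoreT_all R) :=
  HCov_all_iff_G1_and_Core.symm.trans HCov_all_iff_G1T_and_CoreT

/-- **On the cores, unmarked vertices reach the marks past any two vertices**: the instances of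
`HCovCoreT_all` satisfy `MarksReach` (on top of g53's two-connectivity, `conn_sepConfig_of_core`). -/
theorem core_marksReach {V E : Type*} [Fintype E] [DecidableEq V] {ends : E → Sym2 V}
    {o a₁ a₂ a₃ b : V} (h : WReducedT ends o a₁ a₂ a₃ b) : MarksReach ends o a₁ a₂ a₃ b :=
  marksReach_of_wredT h

end Main

end WRed

end Summit.Ventures.PercRepro2
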